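/-
Copyright (c) 2026 the pub-hodgecm-mathlib formalisation cell (harness21).  Prover seat hodgecm-mathlib-LH4-p19 (g3), req620 Track A «(D-RAM) FOUR-FRAME» squad
(STAGE-1b, row (2) of the piece `f_{T₊}`, the (β₂) road (R-36) «PURE-CELL LEDGER»; β₂ WORD #29∕#31 «p19: RAY BANDS» — digit-level constancy of the three literal predicates of an
upper-line RAY cell under perturbations of the digit), 2026-09-05.
-/
import Literature.NumberTheory.LocalFields.WildQuadraticDatumNormSignConductor               -- ★ (LH4-p06 (g3)): `normSign_eq_of_near`; brings ★ `normSign`, `IsRamifiedQuadraticDatum`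
import HarnessLib

/-!
# Crux `H413`, line LH4 «(D-RAM) FOUR-FRAME» — STAGE-1b, row (2), the (β₂) road (R-36), (OFF) residue, RAY bands: «DIGIT CONSTANCY» — the literal predicate
# `LIT⋆(V) = (|κ̂(V)|·|cc(α − ρα)| = |ϖE|^b ∧ κ̂ρκ̂∕(hρh) ∈ N_Θ(Fix ρ))`, `κ̂(V) = κ₀ + jE V·ξ₀`, the sphere `|γ₁(V − W₁)| = 1`, the ball `|γ₁(V − W₁)|·t ≤ 1` and the sign
# implication `ψ` do not move when the fixed digit `V` moves by `|ϖ|^{2d−1}` (resp. by less than the sphere's radius)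

Cell `hodgecm-mathlib` (D-0151), FLOOR 0, crux item H413 = `stmt-HodgeConjecture-24833`, route of record `HCCMUnconditional`; squad F0∕P3c∕LH4; lane
`--supports stmt-HodgeConjecture-24833 --as helper` (count-neutral; pays NO tier-0 row).  THEOREMS ONLY (no `def`, no instance, no notation, no `sorry`, default heartbeats);
★-only imports; states NO law; (β₂) stays a HYPOTHESIS.  Frame: a field `M ⊇ jE(E)` with commuting involutions `ρ` (fixing `jE(E)`) and `Θ` (`Θ ∘ jE = jE ∘ σ`), a reference
pair `κ₀, ξ₀` (`κ₀ + ρκ₀ = 1`, `Θκ₀ = κ₀`, `ρξ₀ = −ξ₀`, `Θξ₀ = ξ₀`, `ξ₀ ≠ 0`), the norm letter `hdeep` at depth `2d − 1`; resp. an abstract valued field `K`.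

WHY (β₂ WORD #29 «p19: RAY BANDS»; the count socket ★ p864098 `cellDiff_eq_zero_of_fibration_reads₄`).  The socket fibres the populated cell over a class system `Rd` of fixed
digits modulo `r = |ϖ|^b` and asks that the literal predicate `LIT`, the sphere predicate `NX` and the sign predicate `ψ` be constant on `r`-balls around member digits
(`hLit`, `hNX`, `hψ`), and ★ F1 `card_filter_sphere_plus_eq_card_filter_not` asks `LIT` to be constant under the sphere's own `U^{(2d−2)}`-twists (`hC`).  On the RAY band
`|γ₁|·|ϖ|^b ≤ |ϖ|^{2d−1}` and `|γ₁| ≥ 1`, so every such perturbation is `≤ |ϖ|^{2d−1}` on `V` and `≤ |ϖ|^{2d−1}` after `γ₁`; this file proves the four constancies at that size.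
* §1 HEAD `litStar_iff_of_near` — with `|ξ₀|·|cc(α − ρα)| = |ϖE|^b` (the upper-line reference pair): `σV = V`, `σV′ = V′`, `|V′ − V| ≤ |ϖ|^{2d−1}` ⟹ (`LIT⋆ V ↔ LIT⋆ V′`)
  (`κ̂′ = κ̂ + η`, `|η| < |κ̂| = |ξ₀|`; `κ̂′ρκ̂′ = w·κ̂ρκ̂` with `w ∈ Fix ρ ∩ Fix Θ`, `|w − 1| ≤ |η|∕|κ̂| ≤ |ϖE|^{2d−1}` ⟹ `w ∈ N_Θ(Fix ρ)` by `hdeep`).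
* §2 `sphere_iff_of_near` (`|γ₁(V′ − V)| < 1`), `ball_mul_iff_of_near` (`|γ₁(V′ − V)|·t ≤ 1`), `psi_iff_of_near` (`|γ₁(V′ − V)| ≤ |ϖ|^{2d−1}`, all fixed: ★ `normSign_eq_of_near`).
HONEST LABEL.  Count-neutral algebra; nothing printed is asserted; no census law is stated; `hU_ray`, `hD_ray`, `hL_ray` stay OPEN; `HC_CM` is proved only modulo the 7 printed
citations (2 remaining named inputs: hLiu418 = `stmt-HodgeConjecture-24832`, h413 = `stmt-HodgeConjecture-24833`) until rung 0 closes.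
## References
* [Serre1979] J.-P. Serre, *Local Fields*, GTM 67 (1979): Ch. V §3 Cor. 3 pp. 85–87 (norm groups `U^{(n)} ⊆ N` for `n ≥ 2d − 1`; conductor of `ω`), Ch. XV §2.
* [Rogawski1990] J. D. Rogawski, *Automorphic Representations of Unitary Groups in Three Variables*, Ann. of Math. Stud. 123 (1990): §4.9 Prop. 4.9.1 (b) p. 55.
* [Kottwitz1986BaseChangeUnits] R. E. Kottwitz, *Base change for unit elements of Hecke algebras*, Compositio Math. 60 (1986): §3 (the digit fibration of a cone cell).
-/

set_option autoImplicit false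

noncomputable section

namespace Summit.HodgeConjecture.HodgeConjecture.Cruxes.H413.F0P3cDyRamUpperRayDigitConstancy

open scoped Valued WithZero
open WithZero
open Literature.NumberTheory.Automorphic.UnitaryThreeFourFrame (IsRamifiedQuadraticDatum normSign)
open Literature.NumberTheory.LocalFields.WildQuadraticDatum (normSign_eq_of_near)

variable {E M : Type} [Field E] [Valued E ℤᵐ⁰] [Field M] [Valued M ℤᵐ⁰] {ρ Θ : M →+* M}

/-! ## §1 The literal predicate `LIT⋆` is constant on `|ϖ|^{2d−1}`-balls of fixed digits -/

/-- **ONE DIRECTION OF §1's HEAD** (the statement is symmetric in `V, V′`): `LIT⋆ V → LIT⋆ V′` for fixed digits `V, V′` with `|V′ − V| ≤ |ϖ|^{2d−1}`, given the reference pair,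
`|ξ₀|·|cA| = |jEϖ|^b` and the norm letter at depth `2d − 1`. [cite: Serre1979, Ch. V §3 Cor. 3 pp. 85–87] [cite: Rogawski1990, §4.9 Prop. 4.9.1 (b) p. 55] -/
theorem litStar_of_near {σ : E →+* E} {ϖ : E} {d : ℕ}
    (jE : E →+* M) (hjiso : ∀ a, Valued.v (jE a) = Valued.v a) (hjfix : ∀ z, ρ z = z ↔ ∃ c, jE c = z) (hΘj : ∀ c, Θ (jE c) = jE (σ c))
    (hρρ : ∀ x, ρ (ρ x) = x) (hvρ : ∀ x, Valued.v (ρ x) = Valued.v x) (hΘρ : ∀ x, Θ (ρ x) = ρ (Θ x))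
    {κ₀ ξ₀ : M} (hκ₀ : κ₀ + ρ κ₀ = 1) (hΘκ₀ : Θ κ₀ = κ₀) (hξ : ρ ξ₀ = -ξ₀) (hΘξ : Θ ξ₀ = ξ₀) (hξ0 : ξ₀ ≠ 0)
    {cA hM : M} {b : ℕ} (hRe : Valued.v ξ₀ * Valued.v cA = Valued.v (jE ϖ) ^ b) (hϖ0 : jE ϖ ≠ 0)
    (hdeep : ∀ u : M, ρ u = u → Θ u = u → Valued.v (u - 1) ≤ Valued.v (jE ϖ) ^ (2 * d - 1) → ∃ c : M, ρ c = c ∧ c * Θ c = u)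
    {V V' : E} (hσV : σ V = V) (hσV' : σ V' = V') (hnear : Valued.v (V' - V) ≤ Valued.v ϖ ^ (2 * d - 1)) (hlt : Valued.v ϖ ^ (2 * d - 1) < 1)
    (hL : Valued.v (κ₀ + jE V * ξ₀) * Valued.v cA = Valued.v (jE ϖ) ^ b ∧
      ∃ e : M, ρ e = e ∧ e * Θ e = (κ₀ + jE V * ξ₀) * ρ (κ₀ + jE V * ξ₀) / (hM * ρ hM)) :
    Valued.v (κ₀ + jE V' * ξ₀) * Valued.v cA = Valued.v (jE ϖ) ^ b ∧
      ∃ e : M, ρ e = e ∧ e * Θ e = (κ₀ + jE V' * ξ₀) * ρ (κ₀ + jE V' * ξ₀) / (hM * ρ hM) := by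
  obtain ⟨hLv, e, hρe, he⟩ := hL
  have hρj : ∀ c : E, ρ (jE c) = jE c := fun c => (hjfix _).2 ⟨c, rfl⟩
  have hjϖv : Valued.v (jE ϖ) = Valued.v ϖ := hjiso ϖ
  have hcA0 : Valued.v cA ≠ 0 := fun h0 => by
    rw [h0, mul_zero] at hRe; exact pow_ne_zero _ ((Valuation.ne_zero_iff _).2 hϖ0) hRe.symm
  set κ : M := κ₀ + jE V * ξ₀ with hκdef
  set η : M := jE (V' - V) * ξ₀ with hηdef
  have hκ' : κ₀ + jE V' * ξ₀ = κ + η := by rw [hκdef, hηdef, map_sub]; ring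
  -- sizes: `|κ| = |ξ₀|`, `|η| ≤ |ϖ|^{2d−1}·|ξ₀| < |κ|`
  have hκv : Valued.v κ = Valued.v ξ₀ := mul_right_cancel₀ hcA0 (hLv.trans hRe.symm)
  have hξpos : (0 : ℤᵐ⁰) < Valued.v ξ₀ := zero_lt_iff.2 ((Valuation.ne_zero_iff _).2 hξ0)
  have hηv : Valued.v η ≤ Valued.v (jE ϖ) ^ (2 * d - 1) * Valued.v κ := by
    rw [hηdef, Valuation.map_mul, hκv, hjiso, hjϖv]; exact mul_le_mul' hnear le_rfl
  have hηlt : Valued.v η < Valued.v κ := by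
    refine hηv.trans_lt ?_
    calc Valued.v (jE ϖ) ^ (2 * d - 1) * Valued.v κ < 1 * Valued.v κ := by
          rw [hκv, hjϖv]; exact mul_lt_mul_of_pos_right hlt hξpos
      _ = Valued.v κ := one_mul _
  have hκ0 : κ ≠ 0 := fun h0 => by rw [h0, map_zero] at hκv; exact hξ0 ((Valuation.zero_iff _).1 hκv.symm)
  have hρκ : ρ κ = 1 - κ := by
    rw [hκdef, map_add, map_mul, hρj, hξ, mul_neg, ← hκ₀]; ring
  have hρκ0 : ρ κ ≠ 0 := fun h0 => hκ0 (by rw [← hρρ κ, h0, map_zero])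
  have hρη : ρ η = -η := by rw [hηdef, map_mul, hρj, hξ, mul_neg]
  have hΘκ : Θ κ = κ := by rw [hκdef, map_add, map_mul, hΘκ₀, hΘj, hσV, hΘξ]
  have hΘη : Θ η = η := by rw [hηdef, map_mul, hΘj, map_sub, hσV, hσV', hΘξ, map_sub]
  -- the twist `w = κ′ρκ′ ∕ (κρκ)`
  set w : M := (κ + η) * ρ (κ + η) / (κ * ρ κ) with hwdef
  have hρw : ρ w = w := by
    rw [hwdef, map_div₀, map_mul, map_mul, hρρ, hρρ]; ring
  have hΘw : Θ w = w := by
    rw [hwdef, map_div₀, map_mul, map_mul, hΘρ, hΘρ, map_add, hΘκ, hΘη]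
  have hw1 : w - 1 = (η * (ρ κ - κ) - η * η) / (κ * ρ κ) := by
    rw [hwdef, map_add, hρη]; field_simp; ring
  have hwv : Valued.v (w - 1) ≤ Valued.v (jE ϖ) ^ (2 * d - 1) := by
    rw [hw1, Valuation.map_div, Valuation.map_mul, hvρ]
    have hκpos : (0 : ℤᵐ⁰) < Valued.v κ * Valued.v κ := mul_pos (hκv ▸ hξpos) (hκv ▸ hξpos)
    rw [div_le_iff₀ hκpos]
    have h1 : Valued.v (η * (ρ κ - κ)) ≤ Valued.v (jE ϖ) ^ (2 * d - 1) * (Valued.v κ * Valued.v κ) := by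
      rw [Valuation.map_mul, ← mul_assoc]
      refine mul_le_mul' hηv ((Valuation.map_sub _ _ _).trans (max_le (by rw [hvρ]) le_rfl))
    have h2 : Valued.v (η * η) ≤ Valued.v (jE ϖ) ^ (2 * d - 1) * (Valued.v κ * Valued.v κ) := by
      rw [Valuation.map_mul, ← mul_assoc]; exact mul_le_mul' hηv hηlt.le
    exact (Valuation.map_sub _ _ _).trans (max_le h1 h2)
  obtain ⟨c, hρc, hc⟩ := hdeep w hρw hΘw hwv
  refine ⟨?_, c * e, by rw [map_mul, hρc, hρe], ?_⟩
  · rw [hκ', Valuation.map_add_eq_of_lt_left _ hηlt]; exact hLv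
  · have hcc : c * e * Θ (c * e) = w * ((κ + η - η) * ρ (κ + η - η) / (hM * ρ hM)) := by
      rw [map_mul, add_sub_cancel_right, ← he, ← hc]; ring
    rw [hcc, hκ', hwdef, add_sub_cancel_right]
    field_simp

/-- **HEAD §1 — «`LIT⋆` IS CONSTANT ON `|ϖ|^{2d−1}`-BALLS OF FIXED DIGITS».**  `jE`-letters, `ρ ∘ ρ = 1`, `ρ` isometric, `Θρ = ρΘ`; the reference pair `κ₀, ξ₀`; `|ξ₀|·|cA| = |jEϖ|^b`
(the upper-line normalisation `|κ̂| = |ξ₀|`); the norm letter `hdeep` at depth `2d − 1`; `|ϖ|^{2d−1} < 1`.  THEN for fixed `V, V′` with `|V′ − V| ≤ |ϖ|^{2d−1}`: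
`LIT⋆ V ↔ LIT⋆ V′`, `LIT⋆ V :≡ |κ₀ + jE V·ξ₀|·|cA| = |jEϖ|^b ∧ ∃ e ∈ Fix ρ, eΘe = κ̂ρκ̂∕(hρh)`.
[cite: Serre1979, Ch. V §3 Cor. 3 pp. 85–87] [cite: Rogawski1990, §4.9 Prop. 4.9.1 (b) p. 55] [cite: Kottwitz1986BaseChangeUnits, §3] -/
theorem litStar_iff_of_near {σ : E →+* E} {ϖ : E} {d : ℕ}
    (jE : E →+* M) (hjiso : ∀ a, Valued.v (jE a) = Valued.v a) (hjfix : ∀ z, ρ z = z ↔ ∃ c, jE c = z) (hΘj : ∀ c, Θ (jE c) = jE (σ c))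
    (hρρ : ∀ x, ρ (ρ x) = x) (hvρ : ∀ x, Valued.v (ρ x) = Valued.v x) (hΘρ : ∀ x, Θ (ρ x) = ρ (Θ x))
    {κ₀ ξ₀ : M} (hκ₀ : κ₀ + ρ κ₀ = 1) (hΘκ₀ : Θ κ₀ = κ₀) (hξ : ρ ξ₀ = -ξ₀) (hΘξ : Θ ξ₀ = ξ₀) (hξ0 : ξ₀ ≠ 0)
    {cA hM : M} {b : ℕ} (hRe : Valued.v ξ₀ * Valued.v cA = Valued.v (jE ϖ) ^ b) (hϖ0 : jE ϖ ≠ 0)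
    (hdeep : ∀ u : M, ρ u = u → Θ u = u → Valued.v (u - 1) ≤ Valued.v (jE ϖ) ^ (2 * d - 1) → ∃ c : M, ρ c = c ∧ c * Θ c = u)
    {V V' : E} (hσV : σ V = V) (hσV' : σ V' = V') (hnear : Valued.v (V' - V) ≤ Valued.v ϖ ^ (2 * d - 1)) (hlt : Valued.v ϖ ^ (2 * d - 1) < 1) :
    (Valued.v (κ₀ + jE V * ξ₀) * Valued.v cA = Valued.v (jE ϖ) ^ b ∧
        ∃ e : M, ρ e = e ∧ e * Θ e = (κ₀ + jE V * ξ₀) * ρ (κ₀ + jE V * ξ₀) / (hM * ρ hM)) ↔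
      (Valued.v (κ₀ + jE V' * ξ₀) * Valued.v cA = Valued.v (jE ϖ) ^ b ∧
        ∃ e : M, ρ e = e ∧ e * Θ e = (κ₀ + jE V' * ξ₀) * ρ (κ₀ + jE V' * ξ₀) / (hM * ρ hM)) := by
  have hnear' : Valued.v (V - V') ≤ Valued.v ϖ ^ (2 * d - 1) := by rw [← neg_sub, Valuation.map_neg]; exact hnear
  exact ⟨litStar_of_near jE hjiso hjfix hΘj hρρ hvρ hΘρ hκ₀ hΘκ₀ hξ hΘξ hξ0 hRe hϖ0 hdeep hσV hσV' hnear hlt,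
    litStar_of_near jE hjiso hjfix hΘj hρρ hvρ hΘρ hκ₀ hΘκ₀ hξ hΘξ hξ0 hRe hϖ0 hdeep hσV' hσV hnear' hlt⟩

/-! ## §2 The sphere, the ball and the sign implication are constant under small perturbations of the digit -/

section KSide

variable {K : Type} [Field K] [Valued K ℤᵐ⁰]

/-- **THE SPHERE DOES NOT MOVE**: `|γ₁(V′ − V)| < 1` ⟹ (`|γ₁(V − W₁)| = 1 ↔ |γ₁(V′ − W₁)| = 1`). [cite: Serre1979, Ch. XV §2] -/
theorem sphere_iff_of_near {γ₁ W₁ V V' : K} (h : Valued.v (γ₁ * (V' - V)) < 1) :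
    Valued.v (γ₁ * (V - W₁)) = 1 ↔ Valued.v (γ₁ * (V' - W₁)) = 1 := by
  have e1 : γ₁ * (V' - W₁) = γ₁ * (V - W₁) + γ₁ * (V' - V) := by ring
  have e2 : γ₁ * (V - W₁) = γ₁ * (V' - W₁) - γ₁ * (V' - V) := by ring
  constructor
  · intro h1; rw [e1, Valuation.map_add_eq_of_lt_left _ (by rw [h1]; exact h), h1]
  · intro h1; rw [e2, Valuation.map_sub_eq_of_lt_left _ (by rw [h1]; exact h), h1]

/-- **THE BALL DOES NOT MOVE**: `|γ₁(V′ − V)|·t ≤ 1` ⟹ (`|γ₁(V − W₁)|·t ≤ 1 ↔ |γ₁(V′ − W₁)|·t ≤ 1`). [cite: Serre1979, Ch. XV §2] -/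
theorem ball_mul_iff_of_near {γ₁ W₁ V V' : K} {t : ℤᵐ⁰} (h : Valued.v (γ₁ * (V' - V)) * t ≤ 1) :
    Valued.v (γ₁ * (V - W₁)) * t ≤ 1 ↔ Valued.v (γ₁ * (V' - W₁)) * t ≤ 1 := by
  have key : ∀ x y : K, Valued.v x * t ≤ 1 → Valued.v y * t ≤ 1 → Valued.v (x + y) * t ≤ 1 := by
    intro x y hx hy
    calc Valued.v (x + y) * t ≤ max (Valued.v x) (Valued.v y) * t := mul_le_mul' (Valuation.map_add _ _ _) le_rfl
      _ ≤ 1 := by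
        rcases le_total (Valued.v x) (Valued.v y) with hxy | hxy
        · rw [max_eq_right hxy]; exact hy
        · rw [max_eq_left hxy]; exact hx
  have h' : Valued.v (-(γ₁ * (V' - V))) * t ≤ 1 := by rw [Valuation.map_neg]; exact h
  have e1 : γ₁ * (V' - W₁) = γ₁ * (V - W₁) + γ₁ * (V' - V) := by ring
  have e2 : γ₁ * (V - W₁) = γ₁ * (V' - W₁) + -(γ₁ * (V' - V)) := by ring
  exact ⟨fun h1 => by rw [e1]; exact key _ _ h1 h, fun h1 => by rw [e2]; exact key _ _ h1 h'⟩

end KSide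

/-- **THE SIGN IMPLICATION `ψ` DOES NOT MOVE**: at a complete sheet datum, `γ₁, W₁, V, V′` fixed, `|γ₁(V′ − V)| ≤ |ϖ|^{2d−1}` ⟹
((`|γ₁(V − W₁)| = 1 → ω(γ₁(V − W₁)) = s₀`) ↔ (`|γ₁(V′ − W₁)| = 1 → ω(γ₁(V′ − W₁)) = s₀`)) (★ `normSign_eq_of_near` at the conductor digit `2d − 1`).
[cite: Serre1979, Ch. V §3 Cor. 3 pp. 85–87; Ch. XV §2] [cite: Rogawski1990, §4.9 Prop. 4.9.1 (b) p. 55] -/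
theorem psi_iff_of_near [CompleteSpace E] {σ : E →+* E} {ϖ : E} {d tE : ℕ} (hD : IsRamifiedQuadraticDatum σ ϖ d tE)
    {γ₁ W₁ V V' : E} (hσγ : σ γ₁ = γ₁) (hσW₁ : σ W₁ = W₁) (hσV : σ V = V) (hσV' : σ V' = V')
    (h : Valued.v (γ₁ * (V' - V)) ≤ Valued.v ϖ ^ (2 * d - 1)) (s₀ : ℤ) :
    (Valued.v (γ₁ * (V - W₁)) = 1 → normSign σ (γ₁ * (V - W₁)) = s₀) ↔ (Valued.v (γ₁ * (V' - W₁)) = 1 → normSign σ (γ₁ * (V' - W₁)) = s₀) := by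
  obtain ⟨-, -, hϖ, -, -, hd1, -⟩ := id hD
  have hϖlt : Valued.v ϖ < 1 := by rw [hϖ, ← exp_zero, exp_lt_exp]; norm_num
  have hlt : Valued.v (γ₁ * (V' - V)) < 1 := h.trans_lt (pow_lt_one₀ zero_le hϖlt (by omega))
  have hsph : Valued.v (γ₁ * (V - W₁)) = 1 ↔ Valued.v (γ₁ * (V' - W₁)) = 1 := sphere_iff_of_near hlt
  have hσg : σ (γ₁ * (V - W₁)) = γ₁ * (V - W₁) := by rw [map_mul, map_sub, hσγ, hσV, hσW₁]
  have hσg' : σ (γ₁ * (V' - W₁)) = γ₁ * (V' - W₁) := by rw [map_mul, map_sub, hσγ, hσV', hσW₁]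
  have hsign : Valued.v (γ₁ * (V - W₁)) = 1 → normSign σ (γ₁ * (V' - W₁)) = normSign σ (γ₁ * (V - W₁)) := fun h1 => by
    refine normSign_eq_of_near hD hσg hσg' h1 (n := 2 * d - 1) le_rfl ?_
    have e : γ₁ * (V - W₁) - γ₁ * (V' - W₁) = -(γ₁ * (V' - V)) := by ring
    rw [e, Valuation.map_neg]; exact h
  constructor
  · intro hψ h1
    have h0 := hsph.2 h1
    rw [hsign h0]; exact hψ h0
  · intro hψ h1
    rw [← hsign h1]; exact hψ (hsph.1 h1)

end Summit.HodgeConjecture.HodgeConjecture.Cruxes.H413.F0P3cDyRamUpperRayDigitConstancy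

end
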